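import Summits.CriticalPhenomena.PercolationContinuityZ3.Theorems.FK.PressureVanHove
import Summits.CriticalPhenomena.PercolationContinuityZ3.Theorems.FK.PressureThermodynamicLimit
import HarnessLib

/-!
# FK-continuity cell, FO-10a (pressure layer): Grimmett 2006, Thm. (4.58), existence clause IN FULL — the random-cluster
# pressure per site exists along every van Hove sequence, for every boundary wiring, with one and the same limit

Registered R96 (cell INBOX l.6711, 2026-08-24); registry row FO-10a-g339; label VHV-C (coordinator fk-4 g200).
Cell `fk-continuity` (bschramm), row FO-10a; support file for the FK-continuity transplant
(`--supports stmt-CriticalPhenomena-4575`); builds on p205010 (kernel theorem, internal audit signed; external expert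
review pending). Pure proofs; no definitions, no named facts, no sorries; general `d`.
UNCONDITIONAL structure; it decides nothing about FH / TP_FK / the value of `p_c(q)`.

`PressureThermodynamicLimit.lean` (the cube / box limit `Φ`, Grimmett's (4.66)–(4.69)) composed with `PressureVanHove.lean`
(the covering estimate, Friedli–Velenik 2017 Thm. 3.6 (3.4)–(3.5)):

* `tendsto_log_rcPartitionFunction_box_div_iff_halfOpenBox` — a real `Φ` is the per-site limit of `log Z^b_{Λ_n}` along the
  boxes (either boundary condition `b`) iff it is the limit of `n^{-d} log Z⁰_{C_n}` along the cubes;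
* **`exists_tendsto_log_rcPartitionFunction_vanHove`** — GRIMMETT THM. (4.58), existence: for `q ≥ 1`, `0 ≤ p ≤ 1` there is
  `Φ ∈ [0, log q]` such that `|Λ|⁻¹ log Z^{B_Λ}_Λ(p,q) → Φ` as `Λ ↑ ℤ^d` in the sense of van Hove, for EVERY family of wired
  boundary sets `B_Λ ⊆ ∂ⁱⁿΛ` (free, wired, or anything in between);
* `tendsto_log_rcPartitionFunction_vanHove_of_tendsto_box` — every box limit (as used throughout the pressure layer:
  `PressureDifferentiability.lean`, `PressureUniquenessCriterion.lean`, …) IS the van Hove limit.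

Honest framing: thermodynamic-limit bookkeeping; no statement about `p_c(q)`; NOT a binder discharge, NOT `_r4`.

## References

* G. Grimmett, *The Random-Cluster Model*, Springer 2006 (`book:grimmett2006-random-cluster-model`): §4.5, Thm. (4.58) and
  its proof, (4.65)–(4.70) [PDF pp. 88–92]. [Grimmett2006]
* S. Friedli, Y. Velenik, *Statistical Mechanics of Lattice Systems*, CUP 2017, §3.2.1 and Thm. 3.6. [FriedliVelenik2017]
-/

noncomputable section

open Finset Filter Topology

namespace Summit.CriticalPhenomena.PercolationContinuityZ3.Theorems.FK

open Literature.Probability.Percolation Literature.Probability.LatticeModels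

variable {d : ℕ}

/-- **Boxes versus cubes**: `Φ` is the per-site limit of `log Z^b_{Λ_n}(p,q)` along the boxes `Λ_n = [-n,n]^d` (boundary
condition `b ∈ {free, wired}`) iff `n^{-d} log Z⁰_{C_n}(p,q) → Φ` along the cubes `C_n = {0,…,n-1}^d` (`q ≥ 1`,
`0 ≤ p ≤ 1`). [cite: Grimmett2006, Thm. (4.58) with (4.69)] -/
theorem tendsto_log_rcPartitionFunction_box_div_iff_halfOpenBox {p q : ℝ} (hp : p ∈ Set.Icc (0 : ℝ) 1) (hq : 1 ≤ q)
    (b : Bool) {Φ : ℝ} :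
    Tendsto (fun n : ℕ =>
      Real.log (rcPartitionFunction (finsetGraph (zdGraph d) (box d n)) p q (boxBC d b n)) / (#(box d n) : ℝ))
        atTop (𝓝 Φ) ↔
    Tendsto (fun n : ℕ =>
      Real.log (rcPartitionFunction (finsetGraph (zdGraph d) (halfOpenBox d n)) p q ∅) / (n : ℝ) ^ d) atTop (𝓝 Φ) := by
  obtain ⟨Φ', hΦ'⟩ := exists_tendsto_log_rcPartitionFunction_halfOpenBox_div (d := d) hp hq
  have hbox := tendsto_log_rcPartitionFunction_boxBC_div_card_of_cube hp hq hΦ' b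
  refine ⟨fun h => ?_, fun h => tendsto_log_rcPartitionFunction_boxBC_div_card_of_cube hp hq h b⟩
  rw [tendsto_nhds_unique h hbox]
  exact hΦ'

/-- **GRIMMETT 2006, THM. (4.58) — existence of the pressure, independent of the boundary condition and of the way in which
`Λ ↑ ℤ^d`**: for `q ≥ 1` and `0 ≤ p ≤ 1` there is `Φ ∈ [0, log q]` such that for every family of wired boundary sets
`B_Λ ⊆ ∂ⁱⁿΛ` (`B_Λ ⊆ wiredBoundary (zdGraph d) Λ`; `B_Λ = ∅` free, `B_Λ = ∂ⁱⁿΛ` wired),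
`|Λ|⁻¹ log Z^{B_Λ}_Λ(p,q) → Φ` as `Λ ↑ ℤ^d` in the sense of van Hove. [cite: Grimmett2006, Thm. (4.58)] -/
theorem exists_tendsto_log_rcPartitionFunction_vanHove {p q : ℝ} (hp : p ∈ Set.Icc (0 : ℝ) 1) (hq : 1 ≤ q) :
    ∃ Φ ∈ Set.Icc 0 (Real.log q), ∀ B : ∀ Λ : Finset (Site d), Set ↥Λ,
      (∀ Λ, B Λ ⊆ wiredBoundary (zdGraph d) Λ) →
      Tendsto (fun Λ : Finset (Site d) =>
        Real.log (rcPartitionFunction (finsetGraph (zdGraph d) Λ) p q (B Λ)) / (#Λ : ℝ)) (vanHove d) (𝓝 Φ) := by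
  obtain ⟨Φ, hΦI, hΦ⟩ := exists_forall_tendsto_log_rcPartitionFunction_box_div (d := d) hp hq
  have hcube := (tendsto_log_rcPartitionFunction_box_div_iff_halfOpenBox hp hq false).1 (hΦ false)
  exact ⟨Φ, hΦI, fun B hB => tendsto_log_rcPartitionFunction_bc_div_card_vanHove hp hq hcube B hB⟩

/-- **Every box limit is the van Hove limit**: if `|Λ_n|⁻¹ log Z^b_{Λ_n}(p,q) → Φ` along the boxes for one boundary condition
`b` (the hypothesis used throughout the pressure layer), then `|Λ|⁻¹ log Z^{B_Λ}_Λ(p,q) → Φ` along every van Hove sequence and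
every family of wired boundary sets `B_Λ ⊆ ∂ⁱⁿΛ`. [cite: Grimmett2006, Thm. (4.58)] -/
theorem tendsto_log_rcPartitionFunction_vanHove_of_tendsto_box {p q : ℝ} (hp : p ∈ Set.Icc (0 : ℝ) 1) (hq : 1 ≤ q)
    {b : Bool} {Φ : ℝ} (hΦ : Tendsto (fun n : ℕ =>
      Real.log (rcPartitionFunction (finsetGraph (zdGraph d) (box d n)) p q (boxBC d b n)) / (#(box d n) : ℝ))
        atTop (𝓝 Φ))
    (B : ∀ Λ : Finset (Site d), Set ↥Λ) (hB : ∀ Λ, B Λ ⊆ wiredBoundary (zdGraph d) Λ) :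
    Tendsto (fun Λ : Finset (Site d) =>
      Real.log (rcPartitionFunction (finsetGraph (zdGraph d) Λ) p q (B Λ)) / (#Λ : ℝ)) (vanHove d) (𝓝 Φ) :=
  tendsto_log_rcPartitionFunction_bc_div_card_vanHove hp hq
    ((tendsto_log_rcPartitionFunction_box_div_iff_halfOpenBox hp hq b).1 hΦ) B hB

/-- The free special case: `|Λ|⁻¹ log Z⁰_Λ(p,q) → Φ` along van Hove sequences whenever `Φ` is a box limit.
[cite: Grimmett2006, Thm. (4.58)] -/
theorem tendsto_log_rcPartitionFunction_free_vanHove_of_tendsto_box {p q : ℝ} (hp : p ∈ Set.Icc (0 : ℝ) 1) (hq : 1 ≤ q)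
    {b : Bool} {Φ : ℝ} (hΦ : Tendsto (fun n : ℕ =>
      Real.log (rcPartitionFunction (finsetGraph (zdGraph d) (box d n)) p q (boxBC d b n)) / (#(box d n) : ℝ))
        atTop (𝓝 Φ)) :
    Tendsto (fun Λ : Finset (Site d) =>
      Real.log (rcPartitionFunction (finsetGraph (zdGraph d) Λ) p q ∅) / (#Λ : ℝ)) (vanHove d) (𝓝 Φ) :=
  tendsto_log_rcPartitionFunction_vanHove_of_tendsto_box hp hq hΦ (fun _ => ∅) fun _ => Set.empty_subset _

end Summit.CriticalPhenomena.PercolationContinuityZ3.Theorems.FK
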